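import Summits.QuantumFields.YangMills.Theorems.ScalingWindowSplitSelfNormalisedSkewnessWitnessBoxMeasure
import Summits.QuantumFields.YangMills.Theorems.ScalingWindowSplitSelfNormalisedSkewnessStubFrameKernel
import Summits.QuantumFields.YangMills.Theorems.CurvatureBoostCovariance.Negative.BetaZeroMoments
import Literature.Probability.LatticeModels.TorusGreenHessianDecay
import HarnessLib

/-!
# `SelfNormalisedSkewness` — negative side: the Parseval frame of `V` and box expectations

Route `ScalingWindowSplit`, crux `stmt-QuantumFields-18944`, line `Sketch` (negation branch), support for the
lead's `stub_witnessAssembly`.  On `V = im d ⊆ ℝ^{Plaquette 4 S}` with the box probability `boxProb S β ε` of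
`WitnessBoxMeasure` we introduce the Parseval frame `frameV p = Π_V e_p` (via `stub_frameKernel`), the Maxwell
kernel `maxwellK` (Gram matrix of the frame), the box functional `boxN` with `E_{boxProb} ψ = N(ψ)/N(1)`, the
per-site observables `cosSite x = Σ_q cos v_{(x,q)}`, `sqSite x = Σ_q v_{(x,q)}²`, and the central moments
`cm2`, `cm3` with their raw-moment polynomials.

References: Lüscher 1999 §3; standard Gaussian calculus.  No definitions of propositions, no named facts.
-/

noncomputable section

open scoped BigOperators ENNReal InnerProductSpace
open MeasureTheory ProbabilityTheory
open Literature.MathematicalPhysics.QuantumLattice Literature.MathematicalPhysics.QuantumFieldTheory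
open Literature.Probability.LatticeModels (TorusSite torusGreen)
open Summit.QuantumFields.YangMills.Theorems.CurvatureBoostCovariance.Negative (card_planes)

namespace Summit.QuantumFields.YangMills.Theorems.SelfNormalisedSkewness.Negative


variable {S : ℕ} [NeZero S]

/-- The mixed second differences `H_{ij}(z) = (∇ᵢ⁺∇ⱼ⁻ G̃)(z)` of the torus Green function. [folklore] -/
def maxwellH (S : ℕ) [NeZero S] (z : TorusSite 4 S) (i j : Fin 4) : ℝ :=
  torusGreen (z + Pi.single i 1) - torusGreen (z + Pi.single i 1 - Pi.single j 1) - torusGreen z +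
    torusGreen (z - Pi.single j 1)

/-- The Maxwell plaquette kernel `πK(n)_{αα'}` (covariance of exact plaquette fields). [folklore] -/
def maxwellK (S : ℕ) [NeZero S] (n : TorusSite 4 S) (α α' : {q : Fin 4 × Fin 4 // q.1 < q.2}) : ℝ :=
  (1 / 2 : ℝ) * (-(maxwellH S n α.1.1 α'.1.1) * (if α.1.2 = α'.1.2 then 1 else 0)
    + maxwellH S n α.1.1 α'.1.2 * (if α.1.2 = α'.1.1 then 1 else 0)
    + maxwellH S n α.1.2 α'.1.1 * (if α.1.1 = α'.1.2 then 1 else 0)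
    - maxwellH S n α.1.2 α'.1.2 * (if α.1.1 = α'.1.1 then 1 else 0))

/-- Defining equation of `maxwellH` (the shape required by the kernel stubs). [folklore] -/
theorem maxwellH_spec : ∀ (z : TorusSite 4 S) (i j : Fin 4), maxwellH S z i j =
    torusGreen (z + Pi.single i 1) - torusGreen (z + Pi.single i 1 - Pi.single j 1) - torusGreen z +
      torusGreen (z - Pi.single j 1) := fun _ _ _ => rfl

/-- Defining equation of `maxwellK` (the shape required by the kernel stubs). [folklore] -/
theorem maxwellK_spec : ∀ (n : TorusSite 4 S) (α α' : {q : Fin 4 × Fin 4 // q.1 < q.2}), maxwellK S n α α' =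
    (1 / 2 : ℝ) * (-(maxwellH S n α.1.1 α'.1.1) * (if α.1.2 = α'.1.2 then 1 else 0)
      + maxwellH S n α.1.1 α'.1.2 * (if α.1.2 = α'.1.1 then 1 else 0)
      + maxwellH S n α.1.2 α'.1.1 * (if α.1.1 = α'.1.2 then 1 else 0)
      - maxwellH S n α.1.2 α'.1.2 * (if α.1.1 = α'.1.1 then 1 else 0)) := fun _ _ _ => rfl

/-- The Parseval frame of `V = im d`: `frameV p = Π_V e_p`. [folklore] -/
def frameV (S : ℕ) [NeZero S] (p : Plaquette 4 S) : LinearMap.range (plaqCoboundary S) :=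
  (LinearMap.range (plaqCoboundary S)).orthogonalProjectionOnto (EuclideanSpace.single p (1 : ℝ))

/-- Parseval identity of the frame. [folklore] -/
theorem sum_sq_inner_frameV (v : LinearMap.range (plaqCoboundary S)) :
    ∑ p, ⟪frameV S p, v⟫_ℝ ^ 2 = ‖v‖ ^ 2 :=
  (stub_frameKernel S (maxwellH S) maxwellH_spec (maxwellK S) maxwellK_spec).1 v

/-- The frame coefficients are the plaquette coordinates. [folklore] -/
theorem inner_frameV (v : LinearMap.range (plaqCoboundary S)) (p : Plaquette 4 S) :
    ⟪frameV S p, v⟫_ℝ = (v : EuclideanSpace ℝ (Plaquette 4 S)) p :=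
  (stub_frameKernel S (maxwellH S) maxwellH_spec (maxwellK S) maxwellK_spec).2.1 v p

/-- The Gram matrix of the frame is the Maxwell kernel. [folklore] -/
theorem inner_frameV_frameV (p q : Plaquette 4 S) : ⟪frameV S p, frameV S q⟫_ℝ = maxwellK S (p.1 - q.1) p.2 q.2 :=
  (stub_frameKernel S (maxwellH S) maxwellH_spec (maxwellK S) maxwellK_spec).2.2 p q

/-- The frame coefficient maps are measurable. [folklore] -/
theorem measurable_inner_frameV (p : Plaquette 4 S) :
    Measurable fun v : LinearMap.range (plaqCoboundary S) => ⟪frameV S p, v⟫_ℝ :=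
  (continuous_const.inner continuous_id).measurable

/-- The box in frame coordinates. [folklore] -/
theorem boxV_eq_frameBox (ε : ℝ) :
    boxV S ε = {v : LinearMap.range (plaqCoboundary S) | ∀ p, |⟪frameV S p, v⟫_ℝ| < ε} := by
  ext v; simp only [boxV, Set.mem_setOf_eq, inner_frameV]

/-- The weight in frame coordinates. [folklore] -/
theorem cosWeight_eq_frame (β : ℝ) (v : LinearMap.range (plaqCoboundary S)) :
    cosWeight S β v = Real.exp (-(β * ∑ p, (1 - Real.cos ⟪frameV S p, v⟫_ℝ))) := by
  simp only [cosWeight, inner_frameV]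

/-- The un-normalised box functional `N(ψ) = ∫_{box} ψ · w dv` in frame coordinates. [folklore] -/
def boxN (S : ℕ) [NeZero S] (β ε : ℝ) (ψ : LinearMap.range (plaqCoboundary S) → ℝ) : ℝ≥0∞ :=
  ∫⁻ v in {v : LinearMap.range (plaqCoboundary S) | ∀ p, |⟪frameV S p, v⟫_ℝ| < ε},
    ENNReal.ofReal (ψ v) * ENNReal.ofReal (Real.exp (-(β * ∑ p, (1 - Real.cos ⟪frameV S p, v⟫_ℝ))))

/-- `N(ψ) = ∫ ψ d(boxMeasure)` for measurable `ψ`. [folklore] -/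
theorem boxN_eq_lintegral_boxMeasure (β ε : ℝ) {ψ : LinearMap.range (plaqCoboundary S) → ℝ} (hψ : Measurable ψ) :
    boxN S β ε ψ = ∫⁻ v, ENNReal.ofReal (ψ v) ∂(boxMeasure S β ε) := by
  rw [lintegral_boxMeasure β ε (fun v => ENNReal.ofReal (ψ v)) (ENNReal.measurable_ofReal.comp hψ), boxN,
    ← boxV_eq_frameBox]
  refine lintegral_congr fun v => ?_
  rw [cosWeight_eq_frame]

/-- `N(1)` is the total mass of `boxMeasure`. [folklore] -/
theorem boxN_one (β ε : ℝ) : boxN S β ε (fun _ => 1) = boxMeasure S β ε Set.univ := by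
  rw [boxN_eq_lintegral_boxMeasure β ε measurable_const]
  simp only [ENNReal.ofReal_one, lintegral_one]

/-- **Box expectations are ratios** `E_{boxProb} ψ = N(ψ)/N(1)` for measurable `ψ ≥ 0`. [folklore] -/
theorem integral_boxProb_eq_div {β ε : ℝ} {ψ : LinearMap.range (plaqCoboundary S) → ℝ} (hψ : Measurable ψ)
    (h0 : ∀ v, 0 ≤ ψ v) :
    ∫ v, ψ v ∂(boxProb S β ε) = (boxN S β ε ψ).toReal / (boxN S β ε fun _ => 1).toReal := by
  rw [boxProb, integral_smul_measure, boxN_one, ENNReal.toReal_inv, smul_eq_mul,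
    integral_eq_lintegral_of_nonneg_ae (ae_of_all _ h0) hψ.aestronglyMeasurable,
    ← boxN_eq_lintegral_boxMeasure β ε hψ, div_eq_inv_mul]

/-- `boxProb` is carried by the box: the frame coordinates are a.s. `< ε` in size. [folklore] -/
theorem ae_abs_inner_frameV_lt (β ε : ℝ) (p : Plaquette 4 S) :
    ∀ᵐ v ∂(boxProb S β ε), |⟪frameV S p, v⟫_ℝ| < ε := by
  have h : ∀ᵐ v ∂(boxProb S β ε), v ∈ boxV S ε := by
    rw [ae_iff]
    exact boxProb_compl_boxV β ε
  filter_upwards [h] with v hv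
  rw [boxV_eq_frameBox] at hv
  exact hv p

/-- The six plaquettes at a site, as a `Finset`. [folklore] -/
def sitePlaqs (x : Site 4 S) : Finset (Plaquette 4 S) :=
  Finset.univ.map ⟨fun q => (x, q), fun _ _ h => (Prod.mk.inj h).2⟩

omit [NeZero S] in
/-- Sums over `sitePlaqs x` are sums over the six planes. [folklore] -/
theorem sum_sitePlaqs (x : Site 4 S) (f : Plaquette 4 S → ℝ) : ∑ p ∈ sitePlaqs x, f p = ∑ q, f (x, q) := by
  simp [sitePlaqs]

omit [NeZero S] in
/-- `#sitePlaqs x ≤ 6`. [folklore] -/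
theorem card_sitePlaqs_le (x : Site 4 S) : (sitePlaqs x).card ≤ 6 := by
  rw [sitePlaqs, Finset.card_map, Finset.card_univ, card_planes]

/-- The per-site plaquette observable on `V`: `Σ_q cos v_{(x,q)}`. [folklore] -/
def cosSite (x : Site 4 S) (v : LinearMap.range (plaqCoboundary S)) : ℝ := ∑ q, Real.cos ⟪frameV S (x, q), v⟫_ℝ

/-- The per-site sum of squares on `V`: `Σ_q v_{(x,q)}²`. [folklore] -/
def sqSite (x : Site 4 S) (v : LinearMap.range (plaqCoboundary S)) : ℝ := ∑ q, ⟪frameV S (x, q), v⟫_ℝ ^ 2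

/-- `cosSite` is measurable. [folklore] -/
theorem measurable_cosSite (x : Site 4 S) : Measurable (cosSite (S := S) x) :=
  Finset.measurable_sum _ fun q _ => Real.measurable_cos.comp (measurable_inner_frameV (x, q))

/-- `sqSite` is measurable. [folklore] -/
theorem measurable_sqSite (x : Site 4 S) : Measurable (sqSite (S := S) x) :=
  Finset.measurable_sum _ fun q _ => (measurable_inner_frameV (x, q)).pow_const 2

/-- `|cosSite x| ≤ 6`. [folklore] -/
theorem abs_cosSite_le (x : Site 4 S) (v : LinearMap.range (plaqCoboundary S)) : |cosSite x v| ≤ 6 := by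
  unfold cosSite
  refine (Finset.abs_sum_le_sum_abs _ _).trans ?_
  calc ∑ q : {q : Fin 4 × Fin 4 // q.1 < q.2}, |Real.cos ⟪frameV S (x, q), v⟫_ℝ|
      ≤ ∑ _q : {q : Fin 4 × Fin 4 // q.1 < q.2}, (1 : ℝ) :=
        Finset.sum_le_sum fun q _ => Real.abs_cos_le_one _
    _ = 6 := by simp [card_planes]

/-- `0 ≤ sqSite x`. [folklore] -/
theorem sqSite_nonneg (x : Site 4 S) (v : LinearMap.range (plaqCoboundary S)) : 0 ≤ sqSite x v :=
  Finset.sum_nonneg fun _ _ => sq_nonneg _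


/-! ### Central moments as polynomials of raw moments -/

section CentralMoments

variable {Ω : Type*} [MeasurableSpace Ω]

/-- Covariance `∫ (X − EX)(Y − EY)`. [folklore] -/
def cm2 (π : Measure Ω) (X Y : Ω → ℝ) : ℝ := ∫ ω, (X ω - ∫ ω', X ω' ∂π) * (Y ω - ∫ ω', Y ω' ∂π) ∂π

/-- Third central mixed moment `∫ (X − EX)(Y − EY)(Z − EZ)`. [folklore] -/
def cm3 (π : Measure Ω) (X Y Z : Ω → ℝ) : ℝ :=
  ∫ ω, (X ω - ∫ ω', X ω' ∂π) * (Y ω - ∫ ω', Y ω' ∂π) * (Z ω - ∫ ω', Z ω' ∂π) ∂π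

variable {π : Measure Ω} [IsProbabilityMeasure π]

/-- `Cov(X,Y) = E[XY] − E[X]E[Y]` (integrable version). [folklore] -/
theorem cm2_eq_poly {X Y : Ω → ℝ} (hX : Integrable X π) (hY : Integrable Y π)
    (hXY : Integrable (fun ω => X ω * Y ω) π) :
    cm2 π X Y = (∫ ω, X ω * Y ω ∂π) - (∫ ω, X ω ∂π) * (∫ ω, Y ω ∂π) := by
  unfold cm2
  set a := ∫ ω', X ω' ∂π
  set b := ∫ ω', Y ω' ∂π
  have hexp : ∀ ω, (X ω - a) * (Y ω - b) = X ω * Y ω - b * X ω - a * Y ω + a * b := fun ω => by ring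
  simp_rw [hexp]
  have i1 : Integrable (fun ω => X ω * Y ω - b * X ω) π := hXY.sub (hX.const_mul b)
  have i2 : Integrable (fun ω => X ω * Y ω - b * X ω - a * Y ω) π := i1.sub (hY.const_mul a)
  rw [integral_add i2 (integrable_const _), integral_sub i1 (hY.const_mul _), integral_sub hXY (hX.const_mul _),
    integral_const_mul, integral_const_mul, integral_const]
  simp only [probReal_univ, smul_eq_mul, one_mul]
  ring

/-- Third central moment as a polynomial of raw moments (integrable version). [folklore] -/
theorem cm3_eq_poly {X Y Z : Ω → ℝ} (hX : Integrable X π) (hY : Integrable Y π) (hZ : Integrable Z π)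
    (hXY : Integrable (fun ω => X ω * Y ω) π) (hXZ : Integrable (fun ω => X ω * Z ω) π)
    (hYZ : Integrable (fun ω => Y ω * Z ω) π) (hXYZ : Integrable (fun ω => X ω * Y ω * Z ω) π) :
    cm3 π X Y Z = (∫ ω, X ω * Y ω * Z ω ∂π) - (∫ ω, X ω ∂π) * (∫ ω, Y ω * Z ω ∂π)
      - (∫ ω, Y ω ∂π) * (∫ ω, X ω * Z ω ∂π) - (∫ ω, Z ω ∂π) * (∫ ω, X ω * Y ω ∂π)
      + 2 * ((∫ ω, X ω ∂π) * (∫ ω, Y ω ∂π) * (∫ ω, Z ω ∂π)) := by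
  unfold cm3
  set a := ∫ ω', X ω' ∂π
  set b := ∫ ω', Y ω' ∂π
  set c := ∫ ω', Z ω' ∂π
  have hexp : ∀ ω, (X ω - a) * (Y ω - b) * (Z ω - c) =
      X ω * Y ω * Z ω - a * (Y ω * Z ω) - b * (X ω * Z ω) - c * (X ω * Y ω)
        + a * b * Z ω + a * c * Y ω + b * c * X ω - a * b * c := fun ω => by ring
  simp_rw [hexp]
  have i1 : Integrable (fun ω => X ω * Y ω * Z ω - a * (Y ω * Z ω)) π := hXYZ.sub (hYZ.const_mul a)
  have i2 : Integrable (fun ω => X ω * Y ω * Z ω - a * (Y ω * Z ω) - b * (X ω * Z ω)) π :=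
    i1.sub (hXZ.const_mul b)
  have i3 : Integrable (fun ω => X ω * Y ω * Z ω - a * (Y ω * Z ω) - b * (X ω * Z ω) - c * (X ω * Y ω)) π :=
    i2.sub (hXY.const_mul c)
  have i4 : Integrable (fun ω => X ω * Y ω * Z ω - a * (Y ω * Z ω) - b * (X ω * Z ω) - c * (X ω * Y ω)
      + a * b * Z ω) π := i3.add (hZ.const_mul (a * b))
  have i5 : Integrable (fun ω => X ω * Y ω * Z ω - a * (Y ω * Z ω) - b * (X ω * Z ω) - c * (X ω * Y ω)
      + a * b * Z ω + a * c * Y ω) π := i4.add (hY.const_mul (a * c))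
  have i6 : Integrable (fun ω => X ω * Y ω * Z ω - a * (Y ω * Z ω) - b * (X ω * Z ω) - c * (X ω * Y ω)
      + a * b * Z ω + a * c * Y ω + b * c * X ω) π := i5.add (hX.const_mul (b * c))
  rw [integral_sub i6 (integrable_const _), integral_add i5 (hX.const_mul _), integral_add i4 (hY.const_mul _),
    integral_add i3 (hZ.const_mul _), integral_sub i2 (hXY.const_mul _), integral_sub i1 (hXZ.const_mul _),
    integral_sub hXYZ (hYZ.const_mul _), integral_const_mul, integral_const_mul, integral_const_mul,
    integral_const_mul, integral_const_mul, integral_const_mul, integral_const]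
  simp only [probReal_univ, smul_eq_mul, one_mul]
  ring

end CentralMoments

/-! ### Elementary perturbation algebra -/

/-- `|xy − x'y'| ≤ |x − x'||y| + |x'||y − y'|`. [folklore] -/
theorem abs_mul_sub_mul_le' (x x' y y' : ℝ) : |x * y - x' * y'| ≤ |x - x'| * |y| + |x'| * |y - y'| := by
  have e : x * y - x' * y' = (x - x') * y + x' * (y - y') := by ring
  rw [e, ← abs_mul, ← abs_mul]
  exact abs_add_le _ _

/-- `|xyz − x'y'z'| ≤ |x − x'||y||z| + |x'||y − y'||z| + |x'||y'||z − z'|`. [folklore] -/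
theorem abs_mul3_sub_mul3_le (x x' y y' z z' : ℝ) :
    |x * y * z - x' * y' * z'| ≤ |x - x'| * |y| * |z| + |x'| * |y - y'| * |z| + |x'| * |y'| * |z - z'| := by
  have e : x * y * z - x' * y' * z' = (x - x') * y * z + x' * (y - y') * z + x' * y' * (z - z') := by ring
  rw [e, ← abs_mul, ← abs_mul, ← abs_mul, ← abs_mul, ← abs_mul, ← abs_mul]
  exact abs_add_three _ _ _

/-- `|a − b − c − d + 2e| ≤ |a| + |b| + |c| + |d| + 2|e|`. [folklore] -/
theorem abs_comb5_le (a b c d e : ℝ) : |a - b - c - d + 2 * e| ≤ |a| + |b| + |c| + |d| + 2 * |e| := by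
  have h1 : |a - b - c - d + 2 * e| ≤ |a - b - c - d| + |2 * e| := abs_add_le _ _
  have h2 : |a - b - c - d| ≤ |a - b - c| + |d| := abs_sub _ _
  have h3 : |a - b - c| ≤ |a - b| + |c| := abs_sub _ _
  have h4 : |a - b| ≤ |a| + |b| := abs_sub _ _
  have h5 : |2 * e| = 2 * |e| := by rw [abs_mul, abs_two]
  linarith

/-- **Raw-to-central transfer, third order.**  If the raw moments of degree `m` agree with `bᵐ ×` the model
moments up to `C bᵐ ξ` and the model moments are bounded by `C₂`, the cubic cumulant polynomials agree up to
`K b³ ξ`. [folklore] -/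
theorem cubic_transfer {b ξ C C₂ m1x m1y m1z m2yz m2xz m2xy m3 g1x g1y g1z g2yz g2xz g2xy g3 : ℝ}
    (hb : 0 ≤ b) (hξ0 : 0 ≤ ξ) (hξ1 : ξ ≤ 2) (hC : 0 ≤ C) (hC₂ : 0 ≤ C₂)
    (h1x : |m1x - b * g1x| ≤ C * b * ξ) (h1y : |m1y - b * g1y| ≤ C * b * ξ) (h1z : |m1z - b * g1z| ≤ C * b * ξ)
    (h2yz : |m2yz - b ^ 2 * g2yz| ≤ C * b ^ 2 * ξ) (h2xz : |m2xz - b ^ 2 * g2xz| ≤ C * b ^ 2 * ξ)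
    (h2xy : |m2xy - b ^ 2 * g2xy| ≤ C * b ^ 2 * ξ) (h3 : |m3 - b ^ 3 * g3| ≤ C * b ^ 3 * ξ)
    (k1x : |g1x| ≤ C₂) (k1y : |g1y| ≤ C₂) (k1z : |g1z| ≤ C₂) (k2yz : |g2yz| ≤ C₂) (k2xz : |g2xz| ≤ C₂)
    (k2xy : |g2xy| ≤ C₂) :
    |(m3 - m1x * m2yz - m1y * m2xz - m1z * m2xy + 2 * (m1x * m1y * m1z)) -
        b ^ 3 * (g3 - g1x * g2yz - g1y * g2xz - g1z * g2xy + 2 * (g1x * g1y * g1z))| ≤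
      (C + 6 * C * (C₂ + 2 * C) + 6 * C * (C₂ + 2 * C) ^ 2) * b ^ 3 * ξ := by
  set M := C₂ + 2 * C with hM
  -- sizes of the raw and model pieces
  have hbg1c : ∀ {g : ℝ}, |g| ≤ C₂ → |b * g| ≤ b * C₂ := fun {g} hg => by
    rw [abs_mul, abs_of_nonneg hb]; exact mul_le_mul_of_nonneg_left hg hb
  have hbg2c : ∀ {g : ℝ}, |g| ≤ C₂ → |b ^ 2 * g| ≤ b ^ 2 * C₂ := fun {g} hg => by
    rw [abs_mul, abs_of_nonneg (by positivity)]; exact mul_le_mul_of_nonneg_left hg (by positivity)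
  have hbg1 : ∀ {g : ℝ}, |g| ≤ C₂ → |b * g| ≤ b * M := fun {g} hg =>
    (hbg1c hg).trans (mul_le_mul_of_nonneg_left (by linarith) hb)
  have hξb : C * b * ξ ≤ 2 * C * b := by nlinarith [mul_nonneg (mul_nonneg hC hb) (sub_nonneg.2 hξ1)]
  have hξb2 : C * b ^ 2 * ξ ≤ 2 * C * b ^ 2 := by
    nlinarith [mul_nonneg (mul_nonneg hC (sq_nonneg b)) (sub_nonneg.2 hξ1)]
  have hm1 : ∀ {m g : ℝ}, |m - b * g| ≤ C * b * ξ → |g| ≤ C₂ → |m| ≤ b * M := fun {m g} hm hg => by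
    have := abs_sub_abs_le_abs_sub m (b * g)
    have := hbg1c hg
    have e : b * M = b * C₂ + 2 * C * b := by rw [hM]; ring
    linarith
  have hm2 : ∀ {m g : ℝ}, |m - b ^ 2 * g| ≤ C * b ^ 2 * ξ → |g| ≤ C₂ → |m| ≤ b ^ 2 * M := fun {m g} hm hg => by
    have := abs_sub_abs_le_abs_sub m (b ^ 2 * g)
    have := hbg2c hg
    have e : b ^ 2 * M = b ^ 2 * C₂ + 2 * C * b ^ 2 := by rw [hM]; ring
    linarith
  -- the pair terms
  have pair : ∀ {m1 g1 m2 g2 : ℝ}, |m1 - b * g1| ≤ C * b * ξ → |g1| ≤ C₂ → |m2 - b ^ 2 * g2| ≤ C * b ^ 2 * ξ →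
      |g2| ≤ C₂ → |m1 * m2 - b ^ 3 * (g1 * g2)| ≤ 2 * C * M * b ^ 3 * ξ := by
    intro m1 g1 m2 g2 e1 f1 e2 f2
    have e : b ^ 3 * (g1 * g2) = (b * g1) * (b ^ 2 * g2) := by ring
    rw [e]
    calc |m1 * m2 - b * g1 * (b ^ 2 * g2)| ≤ |m1 - b * g1| * |m2| + |b * g1| * |m2 - b ^ 2 * g2| :=
          abs_mul_sub_mul_le' _ _ _ _
      _ ≤ (C * b * ξ) * (b ^ 2 * M) + (b * M) * (C * b ^ 2 * ξ) :=
          add_le_add (mul_le_mul e1 (hm2 e2 f2) (abs_nonneg _) (by positivity))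
            (mul_le_mul (hbg1 f1) e2 (abs_nonneg _) (by positivity))
      _ = 2 * C * M * b ^ 3 * ξ := by ring
  -- the triple term
  have triple : |m1x * m1y * m1z - b ^ 3 * (g1x * g1y * g1z)| ≤ 3 * C * M ^ 2 * b ^ 3 * ξ := by
    have e : b ^ 3 * (g1x * g1y * g1z) = (b * g1x) * (b * g1y) * (b * g1z) := by ring
    rw [e]
    calc |m1x * m1y * m1z - b * g1x * (b * g1y) * (b * g1z)|
        ≤ |m1x - b * g1x| * |m1y| * |m1z| + |b * g1x| * |m1y - b * g1y| * |m1z| +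
            |b * g1x| * |b * g1y| * |m1z - b * g1z| := abs_mul3_sub_mul3_le _ _ _ _ _ _
      _ ≤ (C * b * ξ) * (b * M) * (b * M) + (b * M) * (C * b * ξ) * (b * M) + (b * M) * (b * M) * (C * b * ξ) := by
          have a1 := mul_le_mul (mul_le_mul h1x (hm1 h1y k1y) (abs_nonneg _) (by positivity)) (hm1 h1z k1z)
            (abs_nonneg _) (by positivity)
          have a2 := mul_le_mul (mul_le_mul (hbg1 k1x) h1y (abs_nonneg _) (by positivity)) (hm1 h1z k1z)
            (abs_nonneg _) (by positivity)
          have a3 := mul_le_mul (mul_le_mul (hbg1 k1x) (hbg1 k1y) (abs_nonneg _) (by positivity)) h1z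
            (abs_nonneg _) (by positivity)
          linarith
      _ = 3 * C * M ^ 2 * b ^ 3 * ξ := by ring
  have d : (m3 - m1x * m2yz - m1y * m2xz - m1z * m2xy + 2 * (m1x * m1y * m1z)) -
      b ^ 3 * (g3 - g1x * g2yz - g1y * g2xz - g1z * g2xy + 2 * (g1x * g1y * g1z)) =
      (m3 - b ^ 3 * g3) - (m1x * m2yz - b ^ 3 * (g1x * g2yz)) - (m1y * m2xz - b ^ 3 * (g1y * g2xz))
        - (m1z * m2xy - b ^ 3 * (g1z * g2xy)) + 2 * (m1x * m1y * m1z - b ^ 3 * (g1x * g1y * g1z)) := by ring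
  rw [d]
  have p1 := pair h1x k1x h2yz k2yz
  have p2 := pair h1y k1y h2xz k2xz
  have p3 := pair h1z k1z h2xy k2xy
  have := abs_comb5_le (m3 - b ^ 3 * g3) (m1x * m2yz - b ^ 3 * (g1x * g2yz)) (m1y * m2xz - b ^ 3 * (g1y * g2xz))
    (m1z * m2xy - b ^ 3 * (g1z * g2xy)) (m1x * m1y * m1z - b ^ 3 * (g1x * g1y * g1z))
  have eK : (C + 6 * C * (C₂ + 2 * C) + 6 * C * (C₂ + 2 * C) ^ 2) * b ^ 3 * ξ =
      C * b ^ 3 * ξ + 3 * (2 * C * M * b ^ 3 * ξ) + 2 * (3 * C * M ^ 2 * b ^ 3 * ξ) := by rw [hM]; ring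
  rw [eK]
  linarith

/-- **Raw-to-central transfer, second order.** [folklore] -/
theorem quadratic_transfer {b ξ C C₂ m1x m1y m2xy g1x g1y g2xy : ℝ}
    (hb : 0 ≤ b) (hξ0 : 0 ≤ ξ) (hξ1 : ξ ≤ 2) (hC : 0 ≤ C) (hC₂ : 0 ≤ C₂)
    (h1x : |m1x - b * g1x| ≤ C * b * ξ) (h1y : |m1y - b * g1y| ≤ C * b * ξ)
    (h2xy : |m2xy - b ^ 2 * g2xy| ≤ C * b ^ 2 * ξ) (k1x : |g1x| ≤ C₂) (k1y : |g1y| ≤ C₂) :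
    |(m2xy - m1x * m1y) - b ^ 2 * (g2xy - g1x * g1y)| ≤ (C + 2 * C * (C₂ + 2 * C)) * b ^ 2 * ξ := by
  set M := C₂ + 2 * C with hM
  have hbg1c : ∀ {g : ℝ}, |g| ≤ C₂ → |b * g| ≤ b * C₂ := fun {g} hg => by
    rw [abs_mul, abs_of_nonneg hb]; exact mul_le_mul_of_nonneg_left hg hb
  have hbg1 : ∀ {g : ℝ}, |g| ≤ C₂ → |b * g| ≤ b * M := fun {g} hg =>
    (hbg1c hg).trans (mul_le_mul_of_nonneg_left (by linarith) hb)
  have hξb : C * b * ξ ≤ 2 * C * b := by nlinarith [mul_nonneg (mul_nonneg hC hb) (sub_nonneg.2 hξ1)]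
  have hm1 : ∀ {m g : ℝ}, |m - b * g| ≤ C * b * ξ → |g| ≤ C₂ → |m| ≤ b * M := fun {m g} hm hg => by
    have := abs_sub_abs_le_abs_sub m (b * g)
    have := hbg1c hg
    have e : b * M = b * C₂ + 2 * C * b := by rw [hM]; ring
    linarith
  have e : b ^ 2 * (g1x * g1y) = (b * g1x) * (b * g1y) := by ring
  have d : (m2xy - m1x * m1y) - b ^ 2 * (g2xy - g1x * g1y) =
      (m2xy - b ^ 2 * g2xy) - (m1x * m1y - b ^ 2 * (g1x * g1y)) := by ring
  rw [d]
  have hp : |m1x * m1y - b ^ 2 * (g1x * g1y)| ≤ 2 * C * M * b ^ 2 * ξ := by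
    rw [e]
    calc |m1x * m1y - b * g1x * (b * g1y)| ≤ |m1x - b * g1x| * |m1y| + |b * g1x| * |m1y - b * g1y| :=
          abs_mul_sub_mul_le' _ _ _ _
      _ ≤ (C * b * ξ) * (b * M) + (b * M) * (C * b * ξ) :=
          add_le_add (mul_le_mul h1x (hm1 h1y k1y) (abs_nonneg _) (by positivity))
            (mul_le_mul (hbg1 k1x) h1y (abs_nonneg _) (by positivity))
      _ = 2 * C * M * b ^ 2 * ξ := by ring
  have := abs_sub (m2xy - b ^ 2 * g2xy) (m1x * m1y - b ^ 2 * (g1x * g1y))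
  have eK : (C + 2 * C * (C₂ + 2 * C)) * b ^ 2 * ξ = C * b ^ 2 * ξ + 2 * C * M * b ^ 2 * ξ := by rw [hM]; ring
  rw [eK]
  linarith


end Summit.QuantumFields.YangMills.Theorems.SelfNormalisedSkewness.Negative

end
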